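import Summits.CriticalPhenomena.Ising3DConformalLimit.Theses.FKParityRobustness

/-!
# Far merging along dilations forces a non-trivial `U₄` in the scaling limit

Item stmt-CriticalPhenomena-4471 `FarMergingGivesU4` (support, GLUE) of route `FKParityRobustness` of
the sub-problem `Ising3DConformalLimit` (the route `EnergyNotSigmaSquared` files the same item with
a verbatim identical definiens, so `farMergingGivesU4_proof` proves that decl too, by `rfl`-unfolding).

**Statement.** Suppose there are `c > 0` and an injective lattice shape `x : Fin 4 → ℤ³` such that
along infinitely many dilations `L` the critical lattice Ursell function is far from zero,
`U₄^latt(L•x) ≤ -c·⟨σ_{Lx₀}σ_{Lx₁}⟩⟨σ_{Lx₂}σ_{Lx₃}⟩`. Then every pointwise scaling limit `S` of the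
renormalised critical correlators (`HasPointwiseScalingLimit (criticalCorr 3) ρ S`) with a
non-degenerate two-point function has `HasNontrivialU4 S`.

**Proof.** Take the continuum configuration `y = x` (cast to `(ℝ³)⁴`, non-coincident because `x` is
injective) and the meshes `δ_j = 1/L_j` along dilations `L_j ≥ j + 1`. The lattice approximation is
exact, `[y/δ_j] = L_j • x`, so `ρ(δ_j)⁴·⟨σσσσ⟩(L_j x) → S₄(y)` and `ρ(δ_j)²·⟨σσ⟩ → S₂` at the six
pairs (pointwise convergence at the non-coincident configuration `y`; no continuity of `S` is
needed). Multiplying the lattice inequality by `ρ(δ_j)⁴ ≥ 0` and passing to the limit gives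
`U₄(S)(y) ≤ -c·S₂(y₀,y₁)·S₂(y₂,y₃) < 0`.

The analytic core is isolated as `limitConnectedFour_le_of_latticeBound` (any lattice family `G`,
any meshes `δ_j → 0⁺`, any lattice configurations `z_j` with `[y/δ_j] = z_j`).

## References

* M. Aizenman, *Geometric analysis of φ⁴ fields and Ising models*, Comm. Math. Phys. 86 (1982),
  §1 and Prop. 5.3 (the sign and the far-merging form of `U₄`) [AizenmanCMP1982].
-/

namespace Summit.CriticalPhenomena.Ising3DConformalLimit.FKParityRobustnessFarMergingGivesU4

open Filter Topology
open Literature.Probability.LatticeModels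

/-- `![a, b]` is injective as soon as `a ≠ b`. [folklore] -/
theorem injective_vecCons_pair {α : Type*} {a b : α} (h : a ≠ b) : Function.Injective ![a, b] := by
  intro i j hij
  fin_cases i <;> fin_cases j
  · rfl
  · exact absurd hij (by simpa using h)
  · exact absurd hij (by simpa using h.symm)
  · rfl

/-- Casting an injective configuration of lattice sites `x : Fin n → ℤ^d` coordinatewise into
`(ℝ^d)^n` gives an injective (non-coincident) continuum configuration. [folklore] -/
theorem injective_toLp_intCast {d n : ℕ} {x : Fin n → Site d} (hx : Function.Injective x) :
    Function.Injective fun i =>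
      (WithLp.toLp 2 fun k => ((x i k : ℤ) : ℝ) : EuclideanSpace ℝ (Fin d)) := by
  intro i j hij
  refine hx (funext fun k => ?_)
  have h := congrArg (fun v : EuclideanSpace ℝ (Fin d) => v k) hij
  simpa using h

/-- Exactness of the lattice approximation along integer dilations: at mesh `δ = 1/L`, `L : ℕ`,
the lattice point `[z/δ]` of the cast site `z ∈ ℤ^d ⊂ ℝ^d` is `L • z` (also for `L = 0`, where
both sides vanish by the junk value `0⁻¹ = 0`). [folklore] -/
theorem latticeApprox_inv_natCast {d : ℕ} (z : Site d) (L : ℕ) :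
    latticeApprox ((L : ℝ)⁻¹) (WithLp.toLp 2 fun k => ((z k : ℤ) : ℝ) : EuclideanSpace ℝ (Fin d))
      = (L : ℤ) • z := by
  funext k
  simp only [latticeApprox_apply, div_inv_eq_mul, Pi.smul_apply, smul_eq_mul]
  have h : (z k : ℝ) * (L : ℝ) = (((L : ℤ) * z k : ℤ) : ℝ) := by
    push_cast
    ring
  rw [h, Int.floor_intCast]

/-- **Analytic core.** Let `G` be a lattice family with pointwise scaling limit `S`
(renormalisation `ρ`), `y ∈ (ℝ³)⁴` an injective configuration, `δ_j → 0⁺` meshes and `z_j`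
lattice configurations with `[y_i/δ_j] = z_j i`. If along the whole sequence the lattice Ursell
function satisfies `U₄^G(z_j) ≤ -c·G₂(z_j 0, z_j 1)·G₂(z_j 2, z_j 3)`, then the continuum Ursell
function satisfies `U₄(S)(y) ≤ -c·S₂(y₀, y₁)·S₂(y₂, y₃)`. (Transfer of Aizenman's far-merging
bound, Comm. Math. Phys. 86 (1982), Prop. 5.3, to the pointwise limit.) [folklore] -/
theorem limitConnectedFour_le_of_latticeBound {G : LatticeCorrFamily 3} {ρ : ℝ → ℝ}
    {S : CorrFamily 3} (hlim : HasPointwiseScalingLimit G ρ S)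
    {y : Fin 4 → EuclideanSpace ℝ (Fin 3)} (hy : Function.Injective y)
    {δ : ℕ → ℝ} (hδ : Tendsto δ atTop (𝓝[>] (0 : ℝ)))
    {z : ℕ → Fin 4 → Site 3} (hz : ∀ j i, latticeApprox (δ j) (y i) = z j i) {c : ℝ}
    (hineq : ∀ j, G 4 (z j) - (G 2 ![z j 0, z j 1] * G 2 ![z j 2, z j 3]
        + G 2 ![z j 0, z j 2] * G 2 ![z j 1, z j 3] + G 2 ![z j 0, z j 3] * G 2 ![z j 1, z j 2])
        ≤ -(c * (G 2 ![z j 0, z j 1] * G 2 ![z j 2, z j 3]))) :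
    limitConnectedFour S y ≤ -(c * (S 2 ![y 0, y 1] * S 2 ![y 2, y 3])) := by
  -- the four-point correlator along the sequence
  have h4 : Tendsto (fun j => ρ (δ j) ^ 4 * G 4 (z j)) atTop (𝓝 (S 4 y)) := by
    have hy' : y ∈ NonCoincident 3 4 := hy
    refine (((hlim 4).tendsto_at hy').comp hδ).congr fun j => ?_
    have hzj : (fun i => latticeApprox (δ j) (y i)) = z j := funext (hz j)
    simp only [Function.comp_apply, rescaledCorrelator_apply, hzj]
  -- the two-point correlators at the six pairs
  have h2 : ∀ a b : Fin 4, a ≠ b →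
      Tendsto (fun j => ρ (δ j) ^ 2 * G 2 ![z j a, z j b]) atTop (𝓝 (S 2 ![y a, y b])) := by
    intro a b hab
    have hmem : ![y a, y b] ∈ NonCoincident 3 2 := injective_vecCons_pair (hy.ne hab)
    refine (((hlim 2).tendsto_at hmem).comp hδ).congr fun j => ?_
    have hzj : (fun i => latticeApprox (δ j) (![y a, y b] i)) = ![z j a, z j b] := by
      funext i
      fin_cases i <;> simp [hz]
    simp only [Function.comp_apply, rescaledCorrelator_apply, hzj]
  -- the rescaled lattice Ursell function converges to the continuum one
  have hU : Tendsto (fun j => ρ (δ j) ^ 4 * G 4 (z j)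
      - (ρ (δ j) ^ 2 * G 2 ![z j 0, z j 1] * (ρ (δ j) ^ 2 * G 2 ![z j 2, z j 3])
        + ρ (δ j) ^ 2 * G 2 ![z j 0, z j 2] * (ρ (δ j) ^ 2 * G 2 ![z j 1, z j 3])
        + ρ (δ j) ^ 2 * G 2 ![z j 0, z j 3] * (ρ (δ j) ^ 2 * G 2 ![z j 1, z j 2])))
      atTop (𝓝 (limitConnectedFour S y)) :=
    h4.sub ((((h2 0 1 (by decide)).mul (h2 2 3 (by decide))).add
      ((h2 0 2 (by decide)).mul (h2 1 3 (by decide)))).add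
      ((h2 0 3 (by decide)).mul (h2 1 2 (by decide))))
  -- and so does the rescaled right-hand side
  have hV : Tendsto (fun j => -(c * (ρ (δ j) ^ 2 * G 2 ![z j 0, z j 1]
      * (ρ (δ j) ^ 2 * G 2 ![z j 2, z j 3])))) atTop
      (𝓝 (-(c * (S 2 ![y 0, y 1] * S 2 ![y 2, y 3])))) :=
    (((h2 0 1 (by decide)).mul (h2 2 3 (by decide))).const_mul c).neg
  -- the lattice inequality, multiplied by `ρ(δ_j)⁴ ≥ 0`
  refine le_of_tendsto_of_tendsto' hU hV fun j => ?_
  have hρ4 : 0 ≤ ρ (δ j) ^ 4 := by positivity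
  have key := mul_le_mul_of_nonneg_left (hineq j) hρ4
  nlinarith [key]

/-- **Item stmt-CriticalPhenomena-4471** (`FarMergingGivesU4`, route `FKParityRobustness`): far
merging of the critical lattice Ursell function along infinitely many dilations of a fixed
injective lattice shape forces `HasNontrivialU4 S` for every non-degenerate pointwise scaling limit
`S` of the renormalised critical Ising correlators on `ℤ³`. (Glue; the sign mechanism is
Aizenman, Comm. Math. Phys. 86 (1982), Prop. 5.3.) [folklore] -/
theorem farMergingGivesU4_proof :
    Summit.CriticalPhenomena.Ising3DConformalLimit.Theses.FKParityRobustness.FarMergingGivesU4 := by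
  unfold Summit.CriticalPhenomena.Ising3DConformalLimit.Theses.FKParityRobustness.FarMergingGivesU4
  rintro ⟨c, hc, x, hx, hfar⟩ ρ S _ hlim hnd
  -- dilations `L j ≥ j + 1` along which the lattice bound holds
  choose L hLge hLineq using fun j : ℕ => hfar (j + 1)
  -- the continuum configuration `y = x ⊂ ℝ³` and the meshes `δ_j = 1 / L_j → 0⁺`
  have hy : Function.Injective fun i =>
      (WithLp.toLp 2 fun k => ((x i k : ℤ) : ℝ) : EuclideanSpace ℝ (Fin 3)) :=
    injective_toLp_intCast hx
  have hL : Tendsto L atTop atTop := tendsto_atTop_mono hLge (tendsto_add_atTop_nat 1)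
  have hδ : Tendsto (fun j => ((L j : ℝ))⁻¹) atTop (𝓝[>] (0 : ℝ)) :=
    tendsto_inv_atTop_nhdsGT_zero.comp (tendsto_natCast_atTop_atTop.comp hL)
  -- transfer the lattice bound to the limit
  have hle := limitConnectedFour_le_of_latticeBound hlim hy hδ (z := fun j i => (L j : ℤ) • x i)
    (fun j i => latticeApprox_inv_natCast (x i) (L j)) hLineq
  -- the right-hand side is negative by non-degeneracy of `S₂`
  have h01 : 0 < S 2 ![(WithLp.toLp 2 fun k => ((x 0 k : ℤ) : ℝ) : EuclideanSpace ℝ (Fin 3)),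
      WithLp.toLp 2 fun k => ((x 1 k : ℤ) : ℝ)] :=
    hnd _ (injective_vecCons_pair (hy.ne (by decide)))
  have h23 : 0 < S 2 ![(WithLp.toLp 2 fun k => ((x 2 k : ℤ) : ℝ) : EuclideanSpace ℝ (Fin 3)),
      WithLp.toLp 2 fun k => ((x 3 k : ℤ) : ℝ)] :=
    hnd _ (injective_vecCons_pair (hy.ne (by decide)))
  refine ⟨_, hy, ne_of_lt (lt_of_le_of_lt hle ?_)⟩
  have : 0 < c * (S 2 ![(WithLp.toLp 2 fun k => ((x 0 k : ℤ) : ℝ) : EuclideanSpace ℝ (Fin 3)),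
      WithLp.toLp 2 fun k => ((x 1 k : ℤ) : ℝ)]
    * S 2 ![(WithLp.toLp 2 fun k => ((x 2 k : ℤ) : ℝ) : EuclideanSpace ℝ (Fin 3)),
      WithLp.toLp 2 fun k => ((x 3 k : ℤ) : ℝ)]) := by positivity
  linarith

end Summit.CriticalPhenomena.Ising3DConformalLimit.FKParityRobustnessFarMergingGivesU4
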